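/-
COR-CM (cell pub-hodgecm2, stage 2 of the Hodge ladder) — count-neutral kernel combinatorics (seat prover-pub-hodgecm2-b23-g51-0, binder
prover b23, gen 51; lane SYLOW TRANSFER, claim HOME/INBOX.md l.23329; blanket `Census/SylowTransfer*` l.23357).  Theorems only, in seat b09's
intrinsic model (`CMF G c`, `gfaceSet`, `pairSet`, `translates`, `hodgeSpan`, `Block`, `fibreTwo` — consumed BY NAME, nothing restated) plus
Mathlib's Burnside transfer; no definition, no certificate, no `decide`, no named fact, no geometry, no `sorry`.
`Interfaces.lean` (C1), every E term, B01 and `Transposition/*` are untouched.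
HONEST FRAMING: `HC_CM` is NOT proved, here or anywhere in the tree; nothing here is a period or a headline.
-/
import Summits.HodgeConjecture.CorCM.Census.SylowTransferNormalizer
import Summits.HodgeConjecture.CorCM.Census.SylowTransferAbelian
import Summits.HodgeConjecture.CorCM.Census.SylowTransferCyclic
import Summits.HodgeConjecture.CorCM.Census.CyclicCharacterEvenSylowLaw
import Summits.HodgeConjecture.CorCM.Census.IndexTwoCyclicNormalForm

/-!
# Sylow transfer, VI: the Sylow `2`-subgroup `ℤ/2ᵏ × ℤ/2` (`k ≥ 2`) — `μ(G, c) = φ₂(G, c)` for EVERY central involution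

SETTING.  `G` finite with a Sylow `2`-subgroup `P = ⟨u⟩ × ⟨x⟩ ≅ ℤ/2ᵏ × ℤ/2` (`u, x ∈ P` commuting, `ord u = 2ᵏ`, `k ≥ 2`, `x ∉ ⟨u⟩` an involution,
`|P| = 2·ord u`), `P ≠ G`, and `c` a central involution; `c₀ := u^{2^{k−1}}`.
* §1 **THE `u`-EXPONENT** (`exists_expChar`): the additive `E : P → ℤ/2ᵏ`, `uⁱxʲ ↦ i` (part V's normal form).
* §2 **THE ROOTS CHARACTER** (`exists_rootsCharacter`): by part V (`normalizer_le_centralizer_sylow`) BURNSIDE's transfer `V : G →* P` exists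
  (Mathlib `MonoidHom.transferSylow`, normal complement `N` of odd order `[G:P]`); `w := E ∘ V : G → ℤ/2ᵏ` is additive, `w c₀ = 2^{k−1} ≠ 0`,
  takes the value `1`, kills `1, x` and `N` (so `|ker w| ≥ 3`), and has seat b09's ROOTS PROPERTY `d = 1`: every `g` with `w g` odd has
  `c₀ ∈ ⟨g⟩` (the `2`-part of `g` is conjugate into `P` to some `uⁱxʲ` with `i` odd, and `c₀ ∈ ⟨uⁱxʲ⟩` by part V; `c₀` is central).
* §3 **THE LAWS**: `c = c₀` ⟹ seat b09's law for `d = 1` and any kernel `≥ 3` (XXIX `CyclicCharacter.isLeast_card_gfaces_generate_of_roots`) gives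
  **`μ(G, c) = φ₂(G, c) = β(G, c) − 1`** (`isLeast_card_gfaces_generate_fibreTwo_of_sylow_cyclicTimesTwo_sq`); `c ≠ c₀` ⟹ `c ∈ {x·?}` is not a
  square in the abelian `P` and part IV applies (`…_of_sylow_comm_not_sq`).  Together (**`isLeast_card_gfaces_generate_fibreTwo_of_sylow_cyclicTimesTwo`**):
  **for EVERY finite group whose Sylow `2`-subgroup is `ℤ/2ᵏ × ℤ/2` (`k ≥ 2`) and proper, and EVERY central involution `c ≠ 1`: `μ(G, c) = φ₂(G, c)`**
  — after the cyclic Sylow `2`-subgroups (part II) the second complete Sylow class; e.g. every group of order `8·odd > 8` with Sylow `ℤ/4 × ℤ/2`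
  (with parts II, IV: every group of order `8·odd > 8` with ABELIAN Sylow `2`-subgroup, `…_of_card_eq_eight_mul_odd_comm`).
All [folklore] bookkeeping over [Pohlmann1968, Thm 1] in the reading of [Milne1999, Prop. 2.1].

## References
* [Pohlmann1968] H. Pohlmann, Algebraic cycles on abelian varieties of complex multiplication type, Ann. of Math. 88 (1968), Thm 1.
* [Milne1999] J. S. Milne, Lefschetz motives and the Tate conjecture, Compositio Math. 117 (1999), Prop. 2.1, p. 54.
-/

namespace Summit.HodgeConjecture.CorCM.Census.SylowTransfer

open Finset
open Summit.HodgeConjecture.CorCM.Prior.AllgGroup.RfwfAllgGroup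
open Summit.HodgeConjecture.CorCM.Census.BlockParity
open Summit.HodgeConjecture.CorCM.Census.Coinvariant

noncomputable section

variable {G : Type*} [Group G] [Fintype G] [DecidableEq G]

/-! ## §1 The `u`-exponent character of `P = ⟨u⟩ × ⟨x⟩` -/

omit [Fintype G] [DecidableEq G] in
/-- Normal forms are unique modulo `ord u`: `uⁱ xʲ = uⁱ' xʲ'` (`j, j' < 2`) ⟹ `i ≡ i' (mod ord u)`. [folklore] -/
theorem fst_mod_eq_of_normalForm_eq {u x : G} (hxu : x ∉ Subgroup.zpowers u) (hx2 : x * x = 1) {i i' j j' : ℕ} (hj : j < 2) (hj' : j' < 2)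
    (h : u ^ i * x ^ j = u ^ i' * x ^ j') : i % orderOf u = i' % orderOf u := by
  have hjj := snd_eq_of_normalForm_eq hxu hx2 hj hj' h
  subst hjj
  exact pow_inj_mod.mp (mul_right_cancel h)

omit [Fintype G] [DecidableEq G] in
/-- `x^n = x^{n % 2}` for an involution. [folklore] -/
theorem pow_eq_pow_mod_two {x : G} (hx2 : x * x = 1) (n : ℕ) : x ^ n = x ^ (n % 2) := by
  conv_lhs => rw [← Nat.div_add_mod n 2, pow_add, mul_comm, pow_mul_eq_one_of_even hx2 (n / 2) even_two, one_mul]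

omit [Fintype G] [DecidableEq G] in
/-- **THE `u`-EXPONENT**: an additive `E : P → ℤ/2ᵏ` with `E(uⁱ xʲ) = i` (`P = ⟨u⟩ × ⟨x⟩`, `ord u = 2ᵏ`). [folklore] -/
theorem exists_expChar [Finite G] {P : Subgroup G} {u x : G} {k : ℕ} (hu : u ∈ P) (hx : x ∈ P) (hxu : x ∉ Subgroup.zpowers u)
    (hx2 : x * x = 1) (hux : u * x = x * u) (hord : orderOf u = 2 ^ k) (hcard : Nat.card P = 2 * orderOf u) :
    ∃ E : P → ZMod (2 ^ k), (∀ p q : P, E (p * q) = E p + E q) ∧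
      ∀ (p : P) (i j : ℕ), j < 2 → (p : G) = u ^ i * x ^ j → E p = (i : ZMod (2 ^ k)) := by
  have hnf : ∀ p : P, ∃ ij : ℕ × ℕ, ij.1 < orderOf u ∧ ij.2 < 2 ∧ (p : G) = u ^ ij.1 * x ^ ij.2 := fun p => by
    obtain ⟨i, hi, j, hj, h⟩ := exists_normalForm hu hx hxu hx2 hcard p.2
    exact ⟨(i, j), hi, hj, h⟩
  choose nf hnf1 hnf2 hnfeq using hnf
  have hchar : ∀ (p : P) (i j : ℕ), j < 2 → (p : G) = u ^ i * x ^ j → ((nf p).1 : ZMod (2 ^ k)) = (i : ZMod (2 ^ k)) := by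
    intro p i j hj h
    rw [ZMod.natCast_eq_natCast_iff', ← hord]
    exact fst_mod_eq_of_normalForm_eq hxu hx2 (hnf2 p) hj ((hnfeq p).symm.trans h)
  refine ⟨fun p => ((nf p).1 : ZMod (2 ^ k)), fun p q => ?_, hchar⟩
  have hpq : ((p * q : P) : G) = u ^ ((nf p).1 + (nf q).1) * x ^ (((nf p).2 + (nf q).2) % 2) := by
    rw [Subgroup.coe_mul, hnfeq p, hnfeq q, normalForm_mul hux, ← pow_eq_pow_mod_two hx2]
  simp only
  rw [hchar (p * q) _ _ (Nat.mod_lt _ two_pos) hpq, Nat.cast_add]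

/-! ## §2 The roots character of a Sylow `ℤ/2ᵏ × ℤ/2` -/

omit [DecidableEq G] in
/-- **THE ROOTS CHARACTER** of a Sylow `2`-subgroup `P = ⟨u⟩ × ⟨x⟩ ≅ ℤ/2ᵏ × ℤ/2` (`k ≥ 2`, `P ≠ G`): an additive `w : G → ℤ/2ᵏ` with
`w(u^{2^{k−1}}) ≠ 0`, taking the value `1`, with at least three zeros, and with `u^{2^{k−1}} ∈ ⟨g⟩` whenever `w g` is odd (here `u^{2^{k−1}}` is
assumed central). [folklore] -/
theorem exists_rootsCharacter (P : Sylow 2 G) {u x : G} {k : ℕ} (hu : u ∈ (P : Subgroup G)) (hx : x ∈ (P : Subgroup G))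
    (hxu : x ∉ Subgroup.zpowers u) (hx2 : x * x = 1) (hx1 : x ≠ 1) (hux : u * x = x * u) (hord : orderOf u = 2 ^ k) (hk : 2 ≤ k)
    (hcard : Nat.card (P : Subgroup G) = 2 * orderOf u) (hidx : (P : Subgroup G).index ≠ 1)
    (hcen : ∀ y : G, y * u ^ 2 ^ (k - 1) = u ^ 2 ^ (k - 1) * y) :
    ∃ w : G → ZMod (2 ^ k), (∀ a b : G, w (a * b) = w a + w b) ∧ w (u ^ 2 ^ (k - 1)) ≠ 0 ∧ (∃ g₁ : G, w g₁ = 1) ∧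
      (∀ g : G, ¬ 2 ∣ (w g).val → u ^ 2 ^ (k - 1) ∈ Subgroup.zpowers g) ∧ 3 ≤ (univ.filter fun s : G => w s = 0).card := by
  haveI : Fact (Nat.Prime 2) := ⟨Nat.prime_two⟩
  have h1lt : 1 < 2 ^ k := Nat.one_lt_two_pow (by omega)
  have h2k : 2 * 2 ^ (k - 1) = 2 ^ k := by rw [← pow_succ']; congr 1; omega
  -- Burnside's transfer
  have hN := normalizer_le_centralizer_sylow P hu hx hxu hx2 hx1 hux hord hk hcard
  set V := MonoidHom.transferSylow P hN with hV
  set m := (P : Subgroup G).index with hm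
  have hmodd : Odd m := odd_index_sylow P
  have hVP : ∀ {p : G} (hp : p ∈ (P : Subgroup G)), (V p : G) = p ^ m := fun hp => by
    rw [hV, MonoidHom.transferSylow_eq_pow P hN _ hp]
  -- the exponent character
  obtain ⟨E, hE, hEchar⟩ := exists_expChar hu hx hxu hx2 hux hord hcard
  have hE1 : E 1 = 0 := by
    have h := hE 1 1
    rw [mul_one] at h
    simpa using h
  have hEpow : ∀ (p : (P : Subgroup G)) (n : ℕ), E (p ^ n) = n * E p := fun p n => by
    induction n with
    | zero => rw [pow_zero, hE1, Nat.cast_zero, zero_mul]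
    | succ n ih => rw [pow_succ, hE, ih, Nat.cast_succ, add_mul, one_mul]
  set w : G → ZMod (2 ^ k) := fun g => E (V g) with hw
  have hwmul : ∀ a b : G, w (a * b) = w a + w b := fun a b => by simp only [hw, map_mul, hE]
  have hw1 : w 1 = 0 := by simp only [hw, map_one, hE1]
  have hwpow : ∀ (g : G) (n : ℕ), w (g ^ n) = n * w g := fun g n => by
    induction n with
    | zero => rw [pow_zero, hw1, Nat.cast_zero, zero_mul]
    | succ n ih => rw [pow_succ, hwmul, ih, Nat.cast_succ, add_mul, one_mul]
  have hwinv : ∀ g : G, w g⁻¹ = - w g := fun g => by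
    have h := hwmul g⁻¹ g
    rw [inv_mul_cancel, hw1] at h
    exact eq_neg_of_add_eq_zero_left h.symm
  -- `w` on `P`: `w p = m · E p`
  have hwP : ∀ {p : G} (hp : p ∈ (P : Subgroup G)), w p = m * E ⟨p, hp⟩ := fun {p} hp => by
    have hVp : V p = (⟨p, hp⟩ : (P : Subgroup G)) ^ m := Subtype.ext (by rw [hVP hp, SubmonoidClass.coe_pow])
    simp only [hw, hVp, hEpow]
  have hdk : 2 ∣ 2 ^ k := dvd_pow_self 2 (by omega)
  refine ⟨w, hwmul, ?_, ?_, ?_, ?_⟩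
  · -- `w c₀ = m · 2^{k-1} ≠ 0`
    have hc0 : (u ^ 2 ^ (k - 1) : G) = u ^ 2 ^ (k - 1) * x ^ 0 := by rw [pow_zero, mul_one]
    rw [hwP (Subgroup.pow_mem _ hu _), hEchar _ (2 ^ (k - 1)) 0 (by norm_num) hc0, ← Nat.cast_mul, Ne,
      ZMod.natCast_eq_zero_iff]
    intro h
    have h2k' : 2 ^ k = 2 ^ (k - 1) * 2 := by rw [← pow_succ]; congr 1; omega
    rw [h2k', mul_comm m] at h
    exact hmodd.not_two_dvd_nat (Nat.dvd_of_mul_dvd_mul_left (Nat.two_pow_pos _) h)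
  · -- value `1`: `w (u^{m'}) = m' m = 1`
    have hcop : Nat.Coprime m (2 ^ k) := Nat.Coprime.pow_right _ (Nat.coprime_two_right.mpr hmodd)
    obtain ⟨m', -, hm'⟩ := Nat.exists_mul_mod_eq_one_of_coprime hcop h1lt
    refine ⟨u ^ m', ?_⟩
    have hu0 : (u : G) = u ^ 1 * x ^ 0 := by rw [pow_one, pow_zero, mul_one]
    rw [hwpow, hwP hu, hEchar _ 1 0 (by norm_num) hu0, Nat.cast_one, mul_one, ← Nat.cast_mul, mul_comm m' m, ← ZMod.natCast_mod, hm',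
      Nat.cast_one]
  · -- ROOTS
    intro g hg
    obtain ⟨a, b, hb, hab⟩ := Nat.exists_eq_two_pow_mul_odd (orderOf_pos g).ne'
    have hbpos : 0 < b := hb.pos
    set g₂ := g ^ b with hg₂def
    have hg₂ord : orderOf g₂ = 2 ^ a := by
      rw [hg₂def, orderOf_pow' g hbpos.ne', hab, Nat.gcd_mul_left_left, Nat.mul_div_cancel _ hbpos]
    -- `g₂` is conjugate into `P`
    obtain ⟨Q, hQ⟩ := (IsPGroup.of_card (p := 2) (n := a) (by rw [Nat.card_zpowers, hg₂ord]) :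
      IsPGroup 2 (Subgroup.zpowers g₂)).exists_le_sylow
    obtain ⟨h, hh⟩ := MulAction.exists_smul_eq G P Q
    have hg₂Q : g₂ ∈ ((h • P : Sylow 2 G) : Subgroup G) := by rw [hh]; exact hQ (Subgroup.mem_zpowers g₂)
    rw [Sylow.coe_subgroup_smul, Subgroup.mem_smul_pointwise_iff_exists] at hg₂Q
    obtain ⟨p, hp, hpg⟩ := hg₂Q
    rw [MulAut.smul_def, MulAut.conj_apply] at hpg
    have hwp : w p = w g₂ := by rw [← hpg, hwmul, hwmul, hwinv]; ring
    have hwg₂ : w g₂ = (b : ZMod (2 ^ k)) * w g := by rw [hg₂def, hwpow]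
    -- the `u`-exponent of `p` is odd
    obtain ⟨i, -, j, hj, hpij⟩ := exists_normalForm hu hx hxu hx2 hcard hp
    have hEp : E ⟨p, hp⟩ = (i : ZMod (2 ^ k)) := hEchar _ i j hj hpij
    have key : (b : ZMod (2 ^ k)) * w g = ((m * i : ℕ) : ZMod (2 ^ k)) := by rw [← hwg₂, ← hwp, hwP hp, hEp, Nat.cast_mul]
    have hi : Odd i := by
      by_contra hi
      rw [Nat.not_odd_iff_even] at hi
      obtain ⟨r, hr⟩ := hi
      have hval : 2 ∣ ((b : ZMod (2 ^ k)) * w g).val := by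
        rw [key, ZMod.val_natCast, Nat.dvd_mod_iff hdk]
        exact ⟨m * r, by rw [hr]; ring⟩
      rw [ZMod.val_mul, ZMod.val_natCast, Nat.dvd_mod_iff hdk] at hval
      rcases (Nat.Prime.dvd_mul Nat.prime_two).mp hval with h2 | h2
      · exact hb.not_two_dvd_nat ((Nat.dvd_mod_iff hdk).mp h2)
      · exact hg h2
    -- `c₀ ∈ ⟨p⟩`, hence `c₀ = h c₀ h⁻¹ ∈ ⟨g₂⟩ ≤ ⟨g⟩`
    have hc₀p : u ^ 2 ^ (k - 1) ∈ Subgroup.zpowers p := by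
      rw [hpij]; exact pow_half_mem_zpowers_of_odd hord hk hx2 hux hi j
    obtain ⟨z, hz⟩ := Subgroup.mem_zpowers_iff.mp hc₀p
    have hz' : g₂ ^ z = u ^ 2 ^ (k - 1) := by
      rw [← hpg, ← MulAut.conj_apply, ← map_zpow, hz, MulAut.conj_apply]
      exact mul_inv_eq_iff_eq_mul.mpr (hcen h)
    exact Subgroup.mem_zpowers_iff.mpr ⟨b * z, by rw [zpow_mul, zpow_natCast]; exact hz'⟩
  · -- three zeros: `1`, `x`, and a non-trivial element of the normal complement
    have hwx : w x = 0 := by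
      have hx0 : (x : G) = u ^ 0 * x ^ 1 := by rw [pow_zero, pow_one, one_mul]
      rw [hwP hx, hEchar _ 0 1 (by norm_num) hx0, Nat.cast_zero, mul_zero]
    have hcompl := MonoidHom.ker_transferSylow_isComplement' P hN
    have hcardK : Nat.card V.ker = m := hcompl.index_eq_card.symm
    have hne : V.ker ≠ ⊥ := by
      rw [← Subgroup.one_lt_card_iff_ne_bot, hcardK]
      obtain ⟨q, hq⟩ := hmodd
      omega
    obtain ⟨⟨n, hn⟩, hn1⟩ := Subgroup.ne_bot_iff_exists_ne_one.mp hne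
    have hn1' : n ≠ 1 := fun h => hn1 (Subtype.ext h)
    have hwn : w n = 0 := by
      have hVn : V n = 1 := hn
      simp only [hw, hVn, hE1]
    have hnx : n ≠ x := fun h => hx1 (Subgroup.disjoint_def.mp hcompl.disjoint (h ▸ hn) hx)
    refine Finset.two_lt_card.mpr ⟨1, ?_, x, ?_, n, ?_, hx1.symm, hn1'.symm, hnx.symm⟩ <;>
      simp only [Finset.mem_filter, Finset.mem_univ, true_and]
    exacts [hw1, hwx, hwn]

/-! ## §3 The laws -/

/-- **SYLOW `ℤ/2ᵏ × ℤ/2`, `c = u^{2^{k−1}}` THE SQUARE INVOLUTION ⟹ `μ(G, c) = φ₂(G, c)` and `φ₂ + 1 = β`** (seat b09ʼs law for `d = 1`, any kernel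
`≥ 3`, with the ROOTS character of §2). [folklore] -/
theorem isLeast_card_gfaces_generate_fibreTwo_of_sylow_cyclicTimesTwo_root (c : G) (P : Sylow 2 G) {u x : G} {k : ℕ}
    (hu : u ∈ (P : Subgroup G)) (hx : x ∈ (P : Subgroup G)) (hxu : x ∉ Subgroup.zpowers u) (hx2 : x * x = 1) (hx1 : x ≠ 1)
    (hux : u * x = x * u) (hord : orderOf u = 2 ^ k) (hk : 2 ≤ k) (hcard : Nat.card (P : Subgroup G) = 2 * orderOf u)
    (hidx : (P : Subgroup G).index ≠ 1) (hcu : u ^ 2 ^ (k - 1) = c) (hc2 : c * c = 1) (hcen : ∀ y : G, y * c = c * y) :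
    IsLeast {n : ℕ | ∃ S : Finset (CMF G c →₀ ℤ), (↑S ⊆ gfaceSet G c hc2) ∧ S.card = n ∧
      hodgeSpan c hc2 ≤ Submodule.span ℤ (pairSet c) ⊔ Submodule.span ℤ (translates c S)} (fibreTwo c hc2) ∧
    fibreTwo c hc2 + 1 = Fintype.card (Block c) := by
  subst hcu
  obtain ⟨w, hw, hwc, h1, hroots, h3⟩ := exists_rootsCharacter P hu hx hxu hx2 hx1 hux hord hk hcard hidx hcen
  haveI : Fintype (CMF G (u ^ 2 ^ (k - 1))) := Fintype.ofFinite _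
  exact CyclicCharacter.isLeast_card_gfaces_generate_of_roots hw (by omega) hk hc2 hcen hwc h1 hroots h3

/-- **SYLOW `ℤ/2ᵏ × ℤ/2` (`k ≥ 2`), EVERY CENTRAL INVOLUTION: `μ(G, c) = φ₂(G, c)`** — `c` is either the square involution `u^{2^{k−1}}` (§3 root law)
or a non-square of the abelian `P` (part IV, complemented by the coset sign).  `P ≠ G`. [folklore] -/
theorem isLeast_card_gfaces_generate_fibreTwo_of_sylow_cyclicTimesTwo (c : G) (P : Sylow 2 G) {u x : G} {k : ℕ}
    (hu : u ∈ (P : Subgroup G)) (hx : x ∈ (P : Subgroup G)) (hxu : x ∉ Subgroup.zpowers u) (hx2 : x * x = 1) (hx1 : x ≠ 1)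
    (hux : u * x = x * u) (hord : orderOf u = 2 ^ k) (hk : 2 ≤ k) (hcard : Nat.card (P : Subgroup G) = 2 * orderOf u)
    (hidx : (P : Subgroup G).index ≠ 1) (hc2 : c * c = 1) (hc1 : c ≠ 1) (hcen : ∀ y : G, y * c = c * y) :
    IsLeast {n : ℕ | ∃ S : Finset (CMF G c →₀ ℤ), (↑S ⊆ gfaceSet G c hc2) ∧ S.card = n ∧
      hodgeSpan c hc2 ≤ Submodule.span ℤ (pairSet c) ⊔ Submodule.span ℤ (translates c S)} (fibreTwo c hc2) := by
  by_cases hsq : ∃ y ∈ (P : Subgroup G), y * y = c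
  · obtain ⟨y, hy, hyc⟩ := hsq
    obtain ⟨i, -, j, -, rfl⟩ := exists_normalForm hu hx hxu hx2 hcard hy
    have hcu : c = u ^ (2 * i) := by rw [← hyc, ← pow_two, normalForm_sq hx2 hux]
    have hord' : orderOf u = 2 * 2 ^ (k - 1) := by rw [hord, ← pow_succ']; congr 1; omega
    have hcmem : c ∈ Subgroup.zpowers u := by rw [hcu]; exact Subgroup.pow_mem _ (Subgroup.mem_zpowers u) _
    have hc0 : c = u ^ 2 ^ (k - 1) := IndexTwoCyclic.eq_pow_of_mem_zpowers_of_mul_self hord' hcmem hc2 hc1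
    exact (isLeast_card_gfaces_generate_fibreTwo_of_sylow_cyclicTimesTwo_root c P hu hx hxu hx2 hx1 hux hord hk hcard hidx hc0.symm
      hc2 hcen).1
  · exact isLeast_card_gfaces_generate_fibreTwo_of_sylow_comm_not_sq c P
      (fun a ha b hb => comm_of_mem hu hx hxu hx2 hux hcard ha hb) (fun y hy h => hsq ⟨y, hy, h⟩) hc2 hc1 hcen

omit [DecidableEq G] in
/-- The Sylow `2`-subgroup through commuting `u` (order `2ᵏ`) and an involution `x ∉ ⟨u⟩` when `|G| = 2ᵏ⁺¹·odd`: it contains `u, x` and has order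
`2·ord u`. [folklore] -/
theorem exists_sylow_of_elements {u x : G} {k m : ℕ} (hux : u * x = x * u) (hord : orderOf u = 2 ^ k) (hx2 : x * x = 1) (hx1 : x ≠ 1)
    (hG : Fintype.card G = 2 ^ (k + 1) * m) (hm : Odd m) :
    ∃ P : Sylow 2 G, u ∈ (P : Subgroup G) ∧ x ∈ (P : Subgroup G) ∧ Nat.card (P : Subgroup G) = 2 * orderOf u := by
  haveI : Fact (Nat.Prime 2) := ⟨Nat.prime_two⟩
  have hordx : orderOf x = 2 := orderOf_eq_prime (by rw [pow_two, hx2]) hx1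
  have hU : IsPGroup 2 (Subgroup.zpowers u) := IsPGroup.of_card (n := k) (by rw [Nat.card_zpowers, hord])
  have hX : IsPGroup 2 (Subgroup.zpowers x) := IsPGroup.of_card (n := 1) (by rw [Nat.card_zpowers, hordx, pow_one])
  have hle : Subgroup.zpowers x ≤ Subgroup.normalizer (Subgroup.zpowers u : Set G) := by
    rw [Subgroup.zpowers_le]
    refine Subgroup.mem_normalizer_iff.mpr fun y => ?_
    have hc : ∀ y ∈ Subgroup.zpowers u, x * y * x⁻¹ = y := fun y hy => by
      obtain ⟨z, rfl⟩ := Subgroup.mem_zpowers_iff.mp hy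
      rw [mul_inv_eq_iff_eq_mul]
      exact (((show Commute u x from hux).symm).zpow_right z).eq
    constructor
    · intro hy; rwa [hc y hy]
    · intro hy
      have h1 := hc _ hy
      have hxinv : x⁻¹ = x := inv_eq_of_mul_eq_one_right hx2
      have e : x * (x * y * x⁻¹) * x⁻¹ = y := by
        rw [hxinv, show x * (x * y * x) * x = (x * x) * y * (x * x) by group, hx2, one_mul, mul_one]
      rw [e] at h1
      rwa [← h1] at hy
  obtain ⟨P, hP⟩ := (IsPGroup.to_sup_of_normal_right' hX hU hle).exists_le_sylow
  refine ⟨P, hP (Subgroup.mem_sup_right (Subgroup.mem_zpowers u)), hP (Subgroup.mem_sup_left (Subgroup.mem_zpowers x)), ?_⟩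
  have hm0 : m ≠ 0 := fun h => by simp [h] at hm
  rw [Sylow.card_eq_multiplicity, Nat.card_eq_fintype_card, hG, Nat.factorization_mul (by positivity) hm0, Finsupp.add_apply,
    Nat.factorization_eq_zero_of_not_dvd hm.not_two_dvd_nat, add_zero, Nat.factorization_pow, Finsupp.smul_apply, smul_eq_mul,
    Nat.prime_two.factorization_self, mul_one, hord, pow_succ']

/-- **Element form**: `|G| = 2ᵏ⁺¹·m` (`m > 1` odd, `k ≥ 2`), commuting `u` of order `2ᵏ` and an involution `x ∉ ⟨u⟩` — then the Sylow `2`-subgroup is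
`⟨u⟩ × ⟨x⟩ ≅ ℤ/2ᵏ × ℤ/2` and **`μ(G, c) = φ₂(G, c)` for every central involution `c ≠ 1`**. [folklore] -/
theorem isLeast_card_gfaces_generate_fibreTwo_of_cyclicTimesTwo_elements (c : G) {u x : G} {k m : ℕ} (hux : u * x = x * u)
    (hord : orderOf u = 2 ^ k) (hk : 2 ≤ k) (hx2 : x * x = 1) (hx1 : x ≠ 1) (hxu : x ∉ Subgroup.zpowers u)
    (hG : Fintype.card G = 2 ^ (k + 1) * m) (hm : Odd m) (hm1 : m ≠ 1) (hc2 : c * c = 1) (hc1 : c ≠ 1) (hcen : ∀ y : G, y * c = c * y) :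
    IsLeast {n : ℕ | ∃ S : Finset (CMF G c →₀ ℤ), (↑S ⊆ gfaceSet G c hc2) ∧ S.card = n ∧
      hodgeSpan c hc2 ≤ Submodule.span ℤ (pairSet c) ⊔ Submodule.span ℤ (translates c S)} (fibreTwo c hc2) := by
  obtain ⟨P, hu, hx, hcard⟩ := exists_sylow_of_elements hux hord hx2 hx1 hG hm
  refine isLeast_card_gfaces_generate_fibreTwo_of_sylow_cyclicTimesTwo c P hu hx hxu hx2 hx1 hux hord hk hcard ?_ hc2 hc1 hcen
  have h := (P : Subgroup G).card_mul_index
  rw [hcard, hord, Nat.card_eq_fintype_card, hG, ← pow_succ'] at h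
  rw [Nat.eq_of_mul_eq_mul_left (by positivity) h]
  exact hm1

end

end Summit.HodgeConjecture.CorCM.Census.SylowTransfer
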